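import Summits.CriticalPhenomena.PercolationContinuityZ3.Theorems.Transplant.Slab111HubT01P1
import Summits.CriticalPhenomena.PercolationContinuityZ3.Theorems.Transplant.Slab111HubT01P2
import Summits.CriticalPhenomena.PercolationContinuityZ3.Theorems.Transplant.Slab111HubT01P3
import Summits.CriticalPhenomena.PercolationContinuityZ3.Theorems.Transplant.Slab111HubT01P4
import Summits.CriticalPhenomena.PercolationContinuityZ3.Theorems.Transplant.Slab111HubT01P5
import Summits.CriticalPhenomena.PercolationContinuityZ3.Theorems.Transplant.Slab111HubT01P6
import Summits.CriticalPhenomena.PercolationContinuityZ3.Theorems.Transplant.Slab111HubT01P7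
import Summits.CriticalPhenomena.PercolationContinuityZ3.Theorems.Transplant.Slab111HubT01P8
import Summits.CriticalPhenomena.PercolationContinuityZ3.Theorems.Transplant.Slab111HubT01P9
import Summits.CriticalPhenomena.PercolationContinuityZ3.Theorems.Transplant.Slab111HubT01P10
import Summits.CriticalPhenomena.PercolationContinuityZ3.Theorems.Transplant.Slab111HubT01P11
import Summits.CriticalPhenomena.PercolationContinuityZ3.Theorems.Transplant.Slab111HubT01P12
import Summits.CriticalPhenomena.PercolationContinuityZ3.Theorems.Transplant.Slab111HubT01P13
import Summits.CriticalPhenomena.PercolationContinuityZ3.Theorems.Transplant.Slab111HubT01P14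
import Summits.CriticalPhenomena.PercolationContinuityZ3.Theorems.Transplant.Slab111HubT01P15
import Summits.CriticalPhenomena.PercolationContinuityZ3.Theorems.Transplant.Slab111HubT01P16
import Summits.CriticalPhenomena.PercolationContinuityZ3.Theorems.Transplant.Slab111HubT01P17
import Summits.CriticalPhenomena.PercolationContinuityZ3.Theorems.Transplant.Slab111HubT01P18
import Summits.CriticalPhenomena.PercolationContinuityZ3.Theorems.Transplant.Slab111HubT01P19
import Summits.CriticalPhenomena.PercolationContinuityZ3.Theorems.Transplant.Slab111HubT01P20
import Summits.CriticalPhenomena.PercolationContinuityZ3.Theorems.Transplant.Slab111HubT01P21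
import Summits.CriticalPhenomena.PercolationContinuityZ3.Theorems.Transplant.Slab111HubT01P22
import Summits.CriticalPhenomena.PercolationContinuityZ3.Theorems.Transplant.Slab111HubT01R1
import Summits.CriticalPhenomena.PercolationContinuityZ3.Theorems.Transplant.Slab111HubT01R2
import HarnessLib

/-!
# The HUB ROUTING of the `(111)`-films — all tables of the shape `T01` and the node `linkage_T01` at its block types

builds on p205010 (kernel theorem, internal audit signed; external expert review pending) — NOT used in this file.  Lane `prim-bschramm`, seat
`prim-bschramm-p2` (gen 36; class C1b; memo `HOME/bschramm/P2-LATTICES.md` §131–132); helper file (`--supports stmt-CriticalPhenomena-4575 --as helper`).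
**`tabs_T01`** collects the kernel-checked tables of the shape (files `Slab111HubT01P*`); **`linkage_T01`** =
«Slab111HubShapeLink4».`linkage_of_shape4` for «Slab111HubShapeT01» at every block type of its family (`k ≥ 51`).
[cite: DuminilCopinSidoraviciusTassion2016, §2.3 (proof of Fact 2: the three disjoint paths γ_u, γ_v, γ_w in B_R(z))]
-/

noncomputable section

namespace Summit.CriticalPhenomena.PercolationContinuityZ3.Theorems.Transplant

open Literature.Probability.Percolation Literature.Probability.LatticeModels SimpleGraph

namespace Slab111

/-- **ALL TABLES OF THE SHAPE `T01`** (nonzero region columns). [folklore] -/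
theorem tabs_T01 : ∀ q₁ ∈ shapeT01.cols, q₁ ≠ (0, 0) → shapeT01.pcB q₁ = true → ∀ q₂ ∈ shapeT01.cols, q₂ ≠ (0, 0) → shapeT01.pcB q₂ = true →
    ∃ A C : ℕ, tab4OK shapeT01.pcB shapeT01.colsB shapeT01.badG shapeT01.filtG shapeT01.cols q₁ q₂ A C = true := by
  intro q₁ h₁ h01 hp1
  have h₁' : q₁ ∈ ([(0, 0), (1, 0), (0, -1), (-1, 1), (-1, 0), (0, 1), (1, -1), (0, -2), (-2, 2), (-2, 0), (0, 2), (1, 1), (1, -2), (-1, -1), (-2, 1), (-1, 2), (-3, 1), (-3, 2), (-2, -1), (-2, 3), (-1, -2), (-1, 3), (1, -3), (1, 2)] : List (ℤ × ℤ)) := h₁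
  simp only [List.mem_cons, List.not_mem_nil, or_false] at h₁'
  rcases h₁' with rfl | rfl | rfl | rfl | rfl | rfl | rfl | rfl | rfl | rfl | rfl | rfl | rfl | rfl | rfl | rfl | rfl | rfl | rfl | rfl | rfl | rfl | rfl | rfl
  · exact absurd rfl h01
  · exact absurd hp1 (by decide)
  · exact rowT01_1
  · exact rowT01_2
  · exact rowT01_3
  · exact rowT01_4
  · exact absurd hp1 (by decide)
  · exact rowT01_5
  · exact rowT01_6
  · exact rowT01_7
  · exact rowT01_8
  · exact absurd hp1 (by decide)
  · exact absurd hp1 (by decide)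
  · exact rowT01_9
  · exact rowT01_10
  · exact rowT01_11
  · exact rowT01_12
  · exact rowT01_13
  · exact rowT01_14
  · exact rowT01_15
  · exact rowT01_16
  · exact rowT01_17
  · exact absurd hp1 (by decide)
  · exact absurd hp1 (by decide)

/-- **THE NODE OF `ShapedLinkage 3` AT EVERY BLOCK OF THE SHAPE `T01`** (`k ≥ 51`). [folklore] -/
theorem linkage_T01 {k : ℕ} (hk : 51 ≤ k) (z : Site 2) {tD sR sD : ℕ} (htD : tD = 1) (hsR : 3 ≤ sR) (hsD : sR ≤ sD) :
    ∃ W : Set (slab111 k), (∀ x ∈ W, (hexShadow k).sh x ∈ blkR 3 z tD sD) ∧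
      (∀ x, (hexShadow k).sh x ∈ hexBall z 1 → (hexShadow k).sh x ∈ blkR 3 z tD sD → x ∈ W) ∧
      ∀ (E₁ E₂ w' : slab111 k), (hexShadow k).Terminals 3 z 0 tD sR W E₁ E₂ w' →
        ∃ r₁ r₂ : VRouteData (film k) (W ∩ (hexShadow k).lift (blkR 3 z 0 sR)) W E₁ E₂ w', r₁.y = r₂.b ∧ r₁.b = r₂.y :=
  linkage_of_shape4 hk (shapeT01_valid htD hsR hsD) tabs_T01 z

end Slab111

end Summit.CriticalPhenomena.PercolationContinuityZ3.Theorems.Transplant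

end
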